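import Summits.ResolutionOfSingularities.ResolutionOfSingularities.Theorems.HilbertSamuelEliminationSigmaMaxModificationsCorridor3WLadderLocalTower
import Summits.ResolutionOfSingularities.ResolutionOfSingularities.Theorems.HilbertSamuelEliminationSigmaMaxModificationsCorridor3WLadderBlownUpCentre
import Summits.ResolutionOfSingularities.ResolutionOfSingularities.Theorems.HilbertSamuelEliminationCampaignW42TertiaryCycles
import Literature.AlgebraicGeometry.Resolution.RegularSubschemeLocallyIrreducible
import HarnessLib

/-!
# [OURS · L1 W4.2] FROM A MOVING CHAIN TO ITS LOCAL TOWER: the genuine steps of a moving chain with `e ≤ 1` at its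
# blown-up points, and the tower of point blow-ups over `Spec 𝒪_{X_{n_0},x_{n_0}}` carrying the marked local rings —
# grade 1 / units-half of `stub_Wlow3M_char` (crux chain w42, line `w_ladder`; `--supports stmt-…-19249`, helper)

OURS (cell res-hironaka, slot W4.2, seat res-L1-w42-stub-2 gen 3); NOT statements of H. Hironaka's manuscript
[Hironaka2017]. AI-drafted, weaker than expert review. Sorry-free PROOF file (no new definition). Conditional on the
binder of record `CossartJannsenSaito2020_thm_3_14` (CJS Thm. 3.14, numeric form) only, through
`…Corridor3WLadderBlownUpCentre` (at a blown-up marked point with `e ≤ 1` the canonical centre is `𝔪`).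

* `Moving.nonempty_stalkIso_of_step_of_not_isBlownUp` — a WAITING step identifies the local rings at the marked points;
  `Moving.nonempty_stalkIso_of_waiting` — so does a waiting SEGMENT.
* `Moving.exists_genuineStep` — at a BLOWN-UP stage (good state, (F1), `e ≤ 1`, `ν ≠ Φ^{(3)}`): THE canonical centre `C`
  is the reduced structure on its support with `C_{x_n} = 𝔪_{x_n}`, the next marked point `x_{n+1}` is a closed point of
  `Bℓ_C(X_n)` over `x_n`, with its local ring.
* `Moving.exists_localTower_of_movingChain` — **for a MOVING chain from a maximal origin in the (F1) regime
  (`ν ≠ Φ^{(3)}`) whose blown-up marked points have `e ≤ 1`: the genuine stages `n_0 < n_1 < ⋯` and a tower `T` of blow-ups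
  of closed points over `Spec 𝒪_{X_{n_0},x_{n_0}}` with marked closed points `y_j ↦ y_{j−1}` and
  `𝒪_{T.X j, y_j} ≅ 𝒪_{X_{n_j}, x_{n_j}}`**, plus the stage-`0` setting (`KeySetting`, `CharHypothesis`, isolation if
  `x_{n_0}` is isolated in the Hilbert–Samuel locus). This is the object to which CJS Cor. 6.37 (`Corollary637_char`,
  grade `e = 1`) — once `IsFundamentalSequence T 3 y_0 ⊤` is verified from `Thm314_point_locus` / `ProjDir_line` — and
  Def. 6.38 / Thm. 6.40 (grade `2`) apply.

## References

* V. Cossart, U. Jannsen, S. Saito, LNM 2270 (2020): p. 107, Thm. 3.14, Def. 6.34, Cor. 6.37, Def. 6.38. [CossartJannsenSaito2020]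
-/

noncomputable section

-- namespace `…Corridor3.Moving` re-enters `…Corridor3` (module convention of the Moving files)
set_option linter.dupNamespace false

open CategoryTheory CategoryTheory.Limits AlgebraicGeometry TopologicalSpace IsLocalRing
open Literature.AlgebraicGeometry.Resolution Literature.RingTheory.HilbertSamuel
open Scheme.IdealSheafData

universe u

open Summit.ResolutionOfSingularities.ResolutionOfSingularities.Theorems.CampaignW42
open Literature.AlgebraicGeometry.CossartJannsenSaito2020
open Summit.ResolutionOfSingularities.ResolutionOfSingularities.Theorems.SigmaMaxModificationsCorridor3

namespace Summit.ResolutionOfSingularities.ResolutionOfSingularities.Theorems.SigmaMaxModificationsCorridor3.Moving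

variable {R : ∀ S : Scheme.{u}, CentreSeq S → Prop} {N : ℕ} {ν : ℕ → ℕ}

/-! ## Waiting steps identify the local rings at the marked points -/

/-- **A WAITING step identifies the local rings at the marked points**: the blow-up is an isomorphism near the next
marked point (tree `IsBlowup.isIso_compl`, `isIso_stalkMap_of_isIso_morphismRestrict`). [cite: GortzWedhorn2020, Prop. 13.91 (3)] -/
theorem nonempty_stalkIso_of_step_of_not_isBlownUp {s s' : MarkedStage.{u}} (hst : CanonicalNearStep R N ν s s')
    (hnb : ¬ s.IsBlownUp R N ν) : Nonempty (s.W.presheaf.stalk s.pt ≅ s'.W.presheaf.stalk s'.pt) := by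
  haveI : IsLocallyNoetherian s.W := s.ln
  obtain ⟨C, P', hln, x', hcs, hπ, -, -, rfl⟩ := hst
  have hnot : (blowup.π C).base x' ∉ (C.support : Set s.W) := fun h => hnb ⟨C, P', hcs, hπ ▸ h⟩
  haveI := (blowup.isBlowup C).isIso_compl
  haveI := isIso_stalkMap_of_isIso_morphismRestrict (blowup.π C)
    ⟨(C.support : Set s.W)ᶜ, C.support.isClosed.isOpen_compl⟩ x' hnot
  exact ⟨eqToIso (by rw [← hπ]) ≪≫ asIso ((blowup.π C).stalkMap x')⟩

/-- **A waiting SEGMENT identifies the local rings**: if no stage `m` with `a ≤ m < b` is blown up along the chain, then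
`𝒪_{X_a,x_a} ≅ 𝒪_{X_b,x_b}`. [folklore] -/
theorem nonempty_stalkIso_of_waiting {c : ℕ → MarkedStage.{u}} (hstep : ∀ n, CanonicalNearStep R N ν (c n) (c (n + 1)))
    {a b : ℕ} (hab : a ≤ b) (hw : ∀ m, a ≤ m → m < b → ¬ (c m).IsBlownUp R N ν) :
    Nonempty ((c a).W.presheaf.stalk (c a).pt ≅ (c b).W.presheaf.stalk (c b).pt) := by
  induction b, hab using Nat.le_induction with
  | base => exact ⟨Iso.refl _⟩
  | succ b hab ih =>
    obtain ⟨e⟩ := ih fun m hm hmb => hw m hm (Nat.lt_succ_of_lt hmb)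
    obtain ⟨e'⟩ := nonempty_stalkIso_of_step_of_not_isBlownUp (hstep b) (hw b hab (Nat.lt_succ_self b))
    exact ⟨e ≪≫ e'⟩

/-! ## A genuine step at `e ≤ 1`: the data of the local step -/

/-- **THE GENUINE STEP at a blown-up marked point with `e ≤ 1`** (chain from a maximal origin in the (F1) regime,
`ν ≠ Φ^{(3)}`; modulo `CossartJannsenSaito2020_thm_3_14`): THE canonical centre `C` is the reduced structure on its
support (it is permissible, hence regular), `C_{x_n} = 𝔪_{x_n}` (`stalkIdeal_centre_eq_maximalIdeal_of_reaches`), and the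
next marked point is a closed point `x'` of `Bℓ_C(X_n)` over `x_n` with `𝒪_{Bℓ_C(X_n),x'} = 𝒪_{X_{n+1},x_{n+1}}`.
[cite: CossartJannsenSaito2020, Thm. 3.14, Def. 3.1] -/
theorem exists_genuineStep (h314 : CossartJannsenSaito2020_thm_3_14.{u}) (hRf : OracleFunctional R)
    (hRa : OracleAdmissible R) {p : ℕ} {X : Scheme.{u}} [IsLocallyNoetherian X] {x : X}
    (hX : IsMaximalOrigin p 3 ν X x) (hq : Helpers.QCharRegime p 3 ν X x) (hν : ν ≠ iterPSum 3 Phi)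
    {s s' : MarkedStage.{u}} (hreach : Reaches R 3 ν (MarkedStage.init X x) s) (hst : CanonicalNearStep R 3 ν s s')
    (hb : s.IsBlownUp R 3 ν) (he : dirDim s ≤ 1) :
    ∃ (C : s.W.IdealSheafData) (x' : ↥(blowup C)),
      C = vanishingIdeal C.support ∧ stalkIdeal C s.pt = @maximalIdeal (s.W.presheaf.stalk s.pt) _ _ ∧
        (blowup.π C).base x' = s.pt ∧ IsClosed ({x'} : Set ↥(blowup C)) ∧
          Nonempty ((blowup C).presheaf.stalk x' ≅ s'.W.presheaf.stalk s'.pt) := by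
  haveI : IsLocallyNoetherian s.W := s.ln
  obtain ⟨k, _, _, f, -, hft, hqc⟩ := hX.exists_structure
  haveI := hft
  haveI := hqc
  haveI := hX.isReduced
  have hgood : StateGood k R 3 ν s.W s.L s.P :=
    stateGood_of_reaches (stateGood_init_general hRa f hX.dim_le hX.maximal hν) hreach
  obtain ⟨C, P', hcs, hmem⟩ := hb
  have hmax : stalkIdeal C s.pt = maximalIdeal (s.W.presheaf.stalk s.pt) :=
    stalkIdeal_centre_eq_maximalIdeal_of_reaches h314 hRf hRa hX hq hν hreach hst he hcs hmem
  obtain ⟨C₂, P₂', hln, x', hcs₂, hπ, hcl, -, rfl⟩ := hst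
  obtain rfl : C = C₂ := IsCanonicalStep.centre_unique hRf hcs hcs₂
  have hreg : Scheme.IsRegular C.subscheme := isRegular_subscheme_of_isPermissible (hgood.isPermissible hcs)
  exact ⟨C, x', eq_vanishingIdeal_support_of_isRegular C hreg, hmax, hπ, hcl, ⟨Iso.refl _⟩⟩

/-! ## The genuine stages of a moving chain and the local tower -/

/-- **FROM A MOVING CHAIN TO ITS LOCAL TOWER** (modulo `CossartJannsenSaito2020_thm_3_14`): let `c` be a chain of canonical
near steps from a maximal origin `(X, x)` in the (F1) regime with `ν ≠ Φ^{(3)}`, blown up infinitely often, with `e ≤ 1`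
at every blown-up marked point. Then there are the GENUINE STAGES `n_0 < n_1 < ⋯` (all blown-up stages from `n_0` on,
`n_0` the first one) and a tower `T` of blow-ups of closed points with marked closed points `y_j ∈ T.X j`,
`T.C j = {y_j}`, `y_{j+1} ↦ y_j`, and `𝒪_{T.X j,y_j} ≅ 𝒪_{X_{n_j},x_{n_j}}` for all `j`; the setting transfers to stage `0`
from the stage `X_{n_0}` (excellence and `dim ≤ N`, (F1), isolation in the Hilbert–Samuel locus given upper
semicontinuity of `H^N` at `x_{n_0}`). [cite: CossartJannsenSaito2020, p. 107, Def. 6.34, Cor. 6.37, Def. 6.38] -/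
theorem exists_localTower_of_movingChain (h314 : CossartJannsenSaito2020_thm_3_14.{u}) (hRf : OracleFunctional R)
    (hRa : OracleAdmissible R) {p : ℕ} {X : Scheme.{u}} [IsLocallyNoetherian X] {x : X}
    (hX : IsMaximalOrigin p 3 ν X x) (hq : Helpers.QCharRegime p 3 ν X x) (hν : ν ≠ iterPSum 3 Phi)
    {c : ℕ → MarkedStage.{u}} (h0 : Reaches R 3 ν (MarkedStage.init X x) (c 0))
    (hstep : ∀ n, CanonicalNearStep R 3 ν (c n) (c (n + 1))) (hmov : ∀ n, ∃ m, n ≤ m ∧ (c m).IsBlownUp R 3 ν)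
    (hE : ∀ n, (c n).IsBlownUp R 3 ν → dirDim (c n) ≤ 1) :
    ∃ (g : ℕ → ℕ) (T : BlowupTower.{u}) (y : ∀ j, T.X j),
      StrictMono g ∧ (∀ j, (c (g j)).IsBlownUp R 3 ν) ∧ (∀ m, g 0 ≤ m → (c m).IsBlownUp R 3 ν → ∃ j, g j = m) ∧
      (∀ j, T.C j = {y j}) ∧ (∀ j, IsClosed ({y j} : Set (T.X j))) ∧ (∀ j, (T.π j).base (y (j + 1)) = y j) ∧
      (∀ j, Nonempty ((T.X j).presheaf.stalk (y j) ≅ (c (g j)).W.presheaf.stalk (c (g j)).pt)) ∧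
      (∀ N : ℕ, Scheme.IsExcellent (c (g 0)).W → topologicalKrullDim (c (g 0)).W ≤ (N : WithBot ℕ∞) → KeySetting T N) ∧
      (CharHypothesis (c (g 0)).W (c (g 0)).pt → CharHypothesis (T.X 0) (y 0)) ∧
      (∀ N : ℕ, (∀ w : (c (g 0)).W, w ⤳ (c (g 0)).pt →
          Scheme.hsFun (c (g 0)).W N w ≤ Scheme.hsFun (c (g 0)).W N (c (g 0)).pt) →
        @IsIsolatedInHSMaxLocus (c (g 0)).W (c (g 0)).ln N (c (g 0)).pt →
        @IsIsolatedInHSMaxLocus (T.X 0) (T.ln 0) N (y 0)) := by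
  classical
  -- the genuine stages: `next n` = the first blown-up stage `≥ n`
  let next : ℕ → ℕ := fun n => Nat.find (hmov n)
  have next_spec : ∀ n, n ≤ next n ∧ (c (next n)).IsBlownUp R 3 ν := fun n => Nat.find_spec (hmov n)
  have next_min : ∀ n m, n ≤ m → (c m).IsBlownUp R 3 ν → next n ≤ m :=
    fun n m hnm hb => Nat.find_min' (hmov n) ⟨hnm, hb⟩
  have next_wait : ∀ n m, n ≤ m → m < next n → ¬ (c m).IsBlownUp R 3 ν :=
    fun n m hnm hlt hb => absurd (next_min n m hnm hb) (not_le.mpr hlt)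
  let g : ℕ → ℕ := fun j => Nat.rec (next 0) (fun _ gj => next (gj + 1)) j
  have g_zero : g 0 = next 0 := rfl
  have g_succ : ∀ j, g (j + 1) = next (g j + 1) := fun j => rfl
  have g_blown : ∀ j, (c (g j)).IsBlownUp R 3 ν := by
    intro j
    cases j with
    | zero => exact (next_spec 0).2
    | succ j => rw [g_succ]; exact (next_spec _).2
  have g_lt : ∀ j, g j < g (j + 1) := fun j => by
    rw [g_succ]; exact Nat.lt_of_lt_of_le (Nat.lt_succ_self _) (next_spec _).1
  have g_mono : StrictMono g := strictMono_nat_of_lt_succ g_lt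
  have g_all : ∀ m, g 0 ≤ m → (c m).IsBlownUp R 3 ν → ∃ j, g j = m := by
    intro m hm hb
    have hex : ∃ j, m < g (j + 1) := ⟨m, Nat.lt_of_lt_of_le (Nat.lt_succ_self m) (g_mono.id_le (m + 1))⟩
    obtain ⟨j₀, hj₀, hmin⟩ : ∃ j₀, m < g (j₀ + 1) ∧ ∀ k < j₀, ¬ m < g (k + 1) :=
      ⟨Nat.find hex, Nat.find_spec hex, fun k hk => Nat.find_min hex hk⟩
    have hle : g j₀ ≤ m := by
      cases j₀ with
      | zero => exact hm
      | succ k => exact not_lt.mp (hmin k (Nat.lt_succ_self k))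
    refine ⟨j₀, le_antisymm hle (not_lt.mp fun hlt => ?_)⟩
    have h1 : g (j₀ + 1) ≤ m := by rw [g_succ]; exact next_min _ m hlt hb
    exact absurd hj₀ (not_lt.mpr h1)
  -- the genuine step data at each `g j`
  have hreach : ∀ n, Reaches R 3 ν (MarkedStage.init X x) (c n) := reaches_chain h0 hstep
  have hgen := fun j => exists_genuineStep h314 hRf hRa hX hq hν (hreach (g j)) (hstep (g j)) (g_blown j)
    (hE (g j) (g_blown j))
  choose Cc x' hC hmax hπ hcl hiso using hgen
  -- links: `𝒪_{Bℓ,x'_j} ≅ 𝒪_{X_{g j + 1}} ≅ 𝒪_{X_{g (j+1)}}` (waiting segment)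
  have hlink : ∀ j, Nonempty ((blowup (Cc j)).presheaf.stalk (x' j) ≅
      (c (g (j + 1))).W.presheaf.stalk (c (g (j + 1))).pt) := by
    intro j
    obtain ⟨e₁⟩ := hiso j
    obtain ⟨e₂⟩ := nonempty_stalkIso_of_waiting hstep (a := g j + 1) (b := g (j + 1))
      (by rw [g_succ]; exact (next_spec _).1) (fun m hm hlt => next_wait (g j + 1) m hm (by rw [← g_succ]; exact hlt))
    exact ⟨e₁ ≪≫ e₂⟩
  -- the local tower
  haveI : ∀ j, IsLocallyNoetherian (c (g j)).W := fun j => (c (g j)).ln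
  obtain ⟨T, y, hC', hycl, hover, hstalk, hkey, hchar, hisol⟩ :=
    exists_localTower (W := fun j => (c (g j)).W) (W' := fun j => blowup (Cc j)) (fun j => blowup.π (Cc j)) Cc
      (fun j => blowup.isBlowup (Cc j)) hC (fun j => (c (g j)).pt) hmax x' hπ hcl hlink
  exact ⟨g, T, y, g_mono, g_blown, g_all, hC', hycl, hover, hstalk, hkey, hchar, hisol⟩

/-- **FROM A MOVING CHAIN TO ITS LOCAL TOWER, isolation read on `Spec 𝒪_{X_{n_0},x_{n_0}}`** (variant of
`exists_localTower_of_movingChain` through `exists_localTower_spec`; modulo `CossartJannsenSaito2020_thm_3_14`): let `c` be a chain of canonical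
near steps from a maximal origin `(X, x)` in the (F1) regime with `ν ≠ Φ^{(3)}`, blown up infinitely often, with `e ≤ 1`
at every blown-up marked point. Then there are the GENUINE STAGES `n_0 < n_1 < ⋯` (all blown-up stages from `n_0` on,
`n_0` the first one) and a tower `T` of blow-ups of closed points with marked closed points `y_j ∈ T.X j`,
`T.C j = {y_j}`, `y_{j+1} ↦ y_j`, and `𝒪_{T.X j,y_j} ≅ 𝒪_{X_{n_j},x_{n_j}}` for all `j`; the setting transfers to stage `0`
from the stage `X_{n_0}` (excellence and `dim ≤ N`, (F1), isolation in the Hilbert–Samuel locus given upper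
semicontinuity of `H^N` at `x_{n_0}`). [cite: CossartJannsenSaito2020, p. 107, Def. 6.34, Cor. 6.37, Def. 6.38] -/
theorem exists_localTower_of_movingChain_spec (h314 : CossartJannsenSaito2020_thm_3_14.{u}) (hRf : OracleFunctional R)
    (hRa : OracleAdmissible R) {p : ℕ} {X : Scheme.{u}} [IsLocallyNoetherian X] {x : X}
    (hX : IsMaximalOrigin p 3 ν X x) (hq : Helpers.QCharRegime p 3 ν X x) (hν : ν ≠ iterPSum 3 Phi)
    {c : ℕ → MarkedStage.{u}} (h0 : Reaches R 3 ν (MarkedStage.init X x) (c 0))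
    (hstep : ∀ n, CanonicalNearStep R 3 ν (c n) (c (n + 1))) (hmov : ∀ n, ∃ m, n ≤ m ∧ (c m).IsBlownUp R 3 ν)
    (hE : ∀ n, (c n).IsBlownUp R 3 ν → dirDim (c n) ≤ 1) :
    ∃ (g : ℕ → ℕ) (T : BlowupTower.{u}) (y : ∀ j, T.X j),
      StrictMono g ∧ (∀ j, (c (g j)).IsBlownUp R 3 ν) ∧ (∀ m, g 0 ≤ m → (c m).IsBlownUp R 3 ν → ∃ j, g j = m) ∧
      (∀ j, T.C j = {y j}) ∧ (∀ j, IsClosed ({y j} : Set (T.X j))) ∧ (∀ j, (T.π j).base (y (j + 1)) = y j) ∧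
      (∀ j, Nonempty ((T.X j).presheaf.stalk (y j) ≅ (c (g j)).W.presheaf.stalk (c (g j)).pt)) ∧
      (∀ N : ℕ, Scheme.IsExcellent (c (g 0)).W → topologicalKrullDim (c (g 0)).W ≤ (N : WithBot ℕ∞) → KeySetting T N) ∧
      (CharHypothesis (c (g 0)).W (c (g 0)).pt → CharHypothesis (T.X 0) (y 0)) ∧
      (∀ N : ℕ,
        (haveI := (c (g 0)).ln
         IsIsolatedInHSMaxLocus (Spec ((c (g 0)).W.presheaf.stalk (c (g 0)).pt)) N
          (closedPoint ((c (g 0)).W.presheaf.stalk (c (g 0)).pt))) →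
        @IsIsolatedInHSMaxLocus (T.X 0) (T.ln 0) N (y 0)) := by
  classical
  -- the genuine stages: `next n` = the first blown-up stage `≥ n`
  let next : ℕ → ℕ := fun n => Nat.find (hmov n)
  have next_spec : ∀ n, n ≤ next n ∧ (c (next n)).IsBlownUp R 3 ν := fun n => Nat.find_spec (hmov n)
  have next_min : ∀ n m, n ≤ m → (c m).IsBlownUp R 3 ν → next n ≤ m :=
    fun n m hnm hb => Nat.find_min' (hmov n) ⟨hnm, hb⟩
  have next_wait : ∀ n m, n ≤ m → m < next n → ¬ (c m).IsBlownUp R 3 ν :=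
    fun n m hnm hlt hb => absurd (next_min n m hnm hb) (not_le.mpr hlt)
  let g : ℕ → ℕ := fun j => Nat.rec (next 0) (fun _ gj => next (gj + 1)) j
  have g_zero : g 0 = next 0 := rfl
  have g_succ : ∀ j, g (j + 1) = next (g j + 1) := fun j => rfl
  have g_blown : ∀ j, (c (g j)).IsBlownUp R 3 ν := by
    intro j
    cases j with
    | zero => exact (next_spec 0).2
    | succ j => rw [g_succ]; exact (next_spec _).2
  have g_lt : ∀ j, g j < g (j + 1) := fun j => by
    rw [g_succ]; exact Nat.lt_of_lt_of_le (Nat.lt_succ_self _) (next_spec _).1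
  have g_mono : StrictMono g := strictMono_nat_of_lt_succ g_lt
  have g_all : ∀ m, g 0 ≤ m → (c m).IsBlownUp R 3 ν → ∃ j, g j = m := by
    intro m hm hb
    have hex : ∃ j, m < g (j + 1) := ⟨m, Nat.lt_of_lt_of_le (Nat.lt_succ_self m) (g_mono.id_le (m + 1))⟩
    obtain ⟨j₀, hj₀, hmin⟩ : ∃ j₀, m < g (j₀ + 1) ∧ ∀ k < j₀, ¬ m < g (k + 1) :=
      ⟨Nat.find hex, Nat.find_spec hex, fun k hk => Nat.find_min hex hk⟩
    have hle : g j₀ ≤ m := by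
      cases j₀ with
      | zero => exact hm
      | succ k => exact not_lt.mp (hmin k (Nat.lt_succ_self k))
    refine ⟨j₀, le_antisymm hle (not_lt.mp fun hlt => ?_)⟩
    have h1 : g (j₀ + 1) ≤ m := by rw [g_succ]; exact next_min _ m hlt hb
    exact absurd hj₀ (not_lt.mpr h1)
  -- the genuine step data at each `g j`
  have hreach : ∀ n, Reaches R 3 ν (MarkedStage.init X x) (c n) := reaches_chain h0 hstep
  have hgen := fun j => exists_genuineStep h314 hRf hRa hX hq hν (hreach (g j)) (hstep (g j)) (g_blown j)
    (hE (g j) (g_blown j))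
  choose Cc x' hC hmax hπ hcl hiso using hgen
  -- links: `𝒪_{Bℓ,x'_j} ≅ 𝒪_{X_{g j + 1}} ≅ 𝒪_{X_{g (j+1)}}` (waiting segment)
  have hlink : ∀ j, Nonempty ((blowup (Cc j)).presheaf.stalk (x' j) ≅
      (c (g (j + 1))).W.presheaf.stalk (c (g (j + 1))).pt) := by
    intro j
    obtain ⟨e₁⟩ := hiso j
    obtain ⟨e₂⟩ := nonempty_stalkIso_of_waiting hstep (a := g j + 1) (b := g (j + 1))
      (by rw [g_succ]; exact (next_spec _).1) (fun m hm hlt => next_wait (g j + 1) m hm (by rw [← g_succ]; exact hlt))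
    exact ⟨e₁ ≪≫ e₂⟩
  -- the local tower
  haveI : ∀ j, IsLocallyNoetherian (c (g j)).W := fun j => (c (g j)).ln
  obtain ⟨T, y, hC', hycl, hover, hstalk, hkey, hchar, hisol⟩ :=
    exists_localTower_spec (W := fun j => (c (g j)).W) (W' := fun j => blowup (Cc j)) (fun j => blowup.π (Cc j)) Cc
      (fun j => blowup.isBlowup (Cc j)) hC (fun j => (c (g j)).pt) hmax x' hπ hcl hlink
  exact ⟨g, T, y, g_mono, g_blown, g_all, hC', hycl, hover, hstalk, hkey, hchar, hisol⟩

/-- **FROM A MOVING CHAIN TO ITS LOCAL TOWER, with the WAITING PREFIX** (variant of `exists_localTower_of_movingChain_spec`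
recording that no stage before the first genuine stage `n_0` is blown up — so that data at stage `0` of the chain, e.g.
isolation in the Hilbert–Samuel locus, can be transported to `Spec 𝒪_{X_{n_0},x_{n_0}}` along the waiting segment;
modulo `CossartJannsenSaito2020_thm_3_14`): let `c` be a chain of canonical
near steps from a maximal origin `(X, x)` in the (F1) regime with `ν ≠ Φ^{(3)}`, blown up infinitely often, with `e ≤ 1`
at every blown-up marked point. Then there are the GENUINE STAGES `n_0 < n_1 < ⋯` (all blown-up stages from `n_0` on,
`n_0` the first one) and a tower `T` of blow-ups of closed points with marked closed points `y_j ∈ T.X j`,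
`T.C j = {y_j}`, `y_{j+1} ↦ y_j`, and `𝒪_{T.X j,y_j} ≅ 𝒪_{X_{n_j},x_{n_j}}` for all `j`; the setting transfers to stage `0`
from the stage `X_{n_0}` (excellence and `dim ≤ N`, (F1), isolation in the Hilbert–Samuel locus given upper
semicontinuity of `H^N` at `x_{n_0}`). [cite: CossartJannsenSaito2020, p. 107, Def. 6.34, Cor. 6.37, Def. 6.38] -/
theorem exists_localTower_of_movingChain_wait (h314 : CossartJannsenSaito2020_thm_3_14.{u}) (hRf : OracleFunctional R)
    (hRa : OracleAdmissible R) {p : ℕ} {X : Scheme.{u}} [IsLocallyNoetherian X] {x : X}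
    (hX : IsMaximalOrigin p 3 ν X x) (hq : Helpers.QCharRegime p 3 ν X x) (hν : ν ≠ iterPSum 3 Phi)
    {c : ℕ → MarkedStage.{u}} (h0 : Reaches R 3 ν (MarkedStage.init X x) (c 0))
    (hstep : ∀ n, CanonicalNearStep R 3 ν (c n) (c (n + 1))) (hmov : ∀ n, ∃ m, n ≤ m ∧ (c m).IsBlownUp R 3 ν)
    (hE : ∀ n, (c n).IsBlownUp R 3 ν → dirDim (c n) ≤ 1) :
    ∃ (g : ℕ → ℕ) (T : BlowupTower.{u}) (y : ∀ j, T.X j),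
      StrictMono g ∧ (∀ j, (c (g j)).IsBlownUp R 3 ν) ∧ (∀ m, g 0 ≤ m → (c m).IsBlownUp R 3 ν → ∃ j, g j = m) ∧
      (∀ m, m < g 0 → ¬ (c m).IsBlownUp R 3 ν) ∧
      (∀ j, T.C j = {y j}) ∧ (∀ j, IsClosed ({y j} : Set (T.X j))) ∧ (∀ j, (T.π j).base (y (j + 1)) = y j) ∧
      (∀ j, Nonempty ((T.X j).presheaf.stalk (y j) ≅ (c (g j)).W.presheaf.stalk (c (g j)).pt)) ∧
      (∀ N : ℕ, Scheme.IsExcellent (c (g 0)).W → topologicalKrullDim (c (g 0)).W ≤ (N : WithBot ℕ∞) → KeySetting T N) ∧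
      (CharHypothesis (c (g 0)).W (c (g 0)).pt → CharHypothesis (T.X 0) (y 0)) ∧
      (∀ N : ℕ,
        (haveI := (c (g 0)).ln
         IsIsolatedInHSMaxLocus (Spec ((c (g 0)).W.presheaf.stalk (c (g 0)).pt)) N
          (closedPoint ((c (g 0)).W.presheaf.stalk (c (g 0)).pt))) →
        @IsIsolatedInHSMaxLocus (T.X 0) (T.ln 0) N (y 0)) := by
  classical
  -- the genuine stages: `next n` = the first blown-up stage `≥ n`
  let next : ℕ → ℕ := fun n => Nat.find (hmov n)
  have next_spec : ∀ n, n ≤ next n ∧ (c (next n)).IsBlownUp R 3 ν := fun n => Nat.find_spec (hmov n)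
  have next_min : ∀ n m, n ≤ m → (c m).IsBlownUp R 3 ν → next n ≤ m :=
    fun n m hnm hb => Nat.find_min' (hmov n) ⟨hnm, hb⟩
  have next_wait : ∀ n m, n ≤ m → m < next n → ¬ (c m).IsBlownUp R 3 ν :=
    fun n m hnm hlt hb => absurd (next_min n m hnm hb) (not_le.mpr hlt)
  let g : ℕ → ℕ := fun j => Nat.rec (next 0) (fun _ gj => next (gj + 1)) j
  have g_zero : g 0 = next 0 := rfl
  have g_succ : ∀ j, g (j + 1) = next (g j + 1) := fun j => rfl
  have g_blown : ∀ j, (c (g j)).IsBlownUp R 3 ν := by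
    intro j
    cases j with
    | zero => exact (next_spec 0).2
    | succ j => rw [g_succ]; exact (next_spec _).2
  have g_lt : ∀ j, g j < g (j + 1) := fun j => by
    rw [g_succ]; exact Nat.lt_of_lt_of_le (Nat.lt_succ_self _) (next_spec _).1
  have g_mono : StrictMono g := strictMono_nat_of_lt_succ g_lt
  have g_all : ∀ m, g 0 ≤ m → (c m).IsBlownUp R 3 ν → ∃ j, g j = m := by
    intro m hm hb
    have hex : ∃ j, m < g (j + 1) := ⟨m, Nat.lt_of_lt_of_le (Nat.lt_succ_self m) (g_mono.id_le (m + 1))⟩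
    obtain ⟨j₀, hj₀, hmin⟩ : ∃ j₀, m < g (j₀ + 1) ∧ ∀ k < j₀, ¬ m < g (k + 1) :=
      ⟨Nat.find hex, Nat.find_spec hex, fun k hk => Nat.find_min hex hk⟩
    have hle : g j₀ ≤ m := by
      cases j₀ with
      | zero => exact hm
      | succ k => exact not_lt.mp (hmin k (Nat.lt_succ_self k))
    refine ⟨j₀, le_antisymm hle (not_lt.mp fun hlt => ?_)⟩
    have h1 : g (j₀ + 1) ≤ m := by rw [g_succ]; exact next_min _ m hlt hb
    exact absurd hj₀ (not_lt.mpr h1)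
  -- the genuine step data at each `g j`
  have hreach : ∀ n, Reaches R 3 ν (MarkedStage.init X x) (c n) := reaches_chain h0 hstep
  have hgen := fun j => exists_genuineStep h314 hRf hRa hX hq hν (hreach (g j)) (hstep (g j)) (g_blown j)
    (hE (g j) (g_blown j))
  choose Cc x' hC hmax hπ hcl hiso using hgen
  -- links: `𝒪_{Bℓ,x'_j} ≅ 𝒪_{X_{g j + 1}} ≅ 𝒪_{X_{g (j+1)}}` (waiting segment)
  have hlink : ∀ j, Nonempty ((blowup (Cc j)).presheaf.stalk (x' j) ≅
      (c (g (j + 1))).W.presheaf.stalk (c (g (j + 1))).pt) := by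
    intro j
    obtain ⟨e₁⟩ := hiso j
    obtain ⟨e₂⟩ := nonempty_stalkIso_of_waiting hstep (a := g j + 1) (b := g (j + 1))
      (by rw [g_succ]; exact (next_spec _).1) (fun m hm hlt => next_wait (g j + 1) m hm (by rw [← g_succ]; exact hlt))
    exact ⟨e₁ ≪≫ e₂⟩
  -- the local tower
  haveI : ∀ j, IsLocallyNoetherian (c (g j)).W := fun j => (c (g j)).ln
  obtain ⟨T, y, hC', hycl, hover, hstalk, hkey, hchar, hisol⟩ :=
    exists_localTower_spec (W := fun j => (c (g j)).W) (W' := fun j => blowup (Cc j)) (fun j => blowup.π (Cc j)) Cc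
      (fun j => blowup.isBlowup (Cc j)) hC (fun j => (c (g j)).pt) hmax x' hπ hcl hlink
  exact ⟨g, T, y, g_mono, g_blown, g_all, fun m hm => next_wait 0 m (Nat.zero_le m) hm, hC', hycl, hover, hstalk,
    hkey, hchar, hisol⟩

end Summit.ResolutionOfSingularities.ResolutionOfSingularities.Theorems.SigmaMaxModificationsCorridor3.Moving

end
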